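import Summits.ResolutionOfSingularities.ResolutionOfSingularities.Theorems.PurelyInseparableDim4Scope
import Summits.ResolutionOfSingularities.ResolutionOfSingularities.Theorems.PurelyInseparableDim4GameDeterminacy
import HarnessLib
import HarnessLib.Audit.Tags

/-!
# Purely inseparable fourfolds — the frame-v4 statements F4-S / F4-C / F4-I in KILL-CERTIFICATE form
# [OURS · counted 0 · statements about OUR frame (`PurelyInseparableDim4Scope`), not about resolution]

Census cell «res-dim4-pi» (D-0157 DOOR 2), width seat `res-dim4-p-14`, brick PR-12d.  The Scope add-on
(`PurelyInseparableDim4Scope`, frame v4, WORD #20/#23) re-scopes the refuted `TerminatesSomeRule` to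
F4-S `SpineTerminatesSomeRule` (chart origins only), F4-C `TerminatesInScope` (branches inside the
coordinate scope) and F4-I `NoIsolatedTrap` (point blow-ups through isolated `q`-fold points).  With the
determinacy layer of `PurelyInseparableDim4GameDeterminacy` (`Game.Wins`, traps = complement of the
attractor) each of them gets the SAME certificate shape as `not_terminatesSomeRule_iff_exists_trap`:

* **`not_spineTerminatesSomeRule_iff_exists_spineTrap`** — F4-S fails iff some field of characteristic
  `p` carries a nonempty SPINE TRAP of states (every permissible centre answered by a spine edge inside
  the set); `spineTerminatesSomeRule_iff_forall_wins`;
* **`not_terminatesInScope_iff_exists_inScopeTrap`** — F4-C fails iff some field of characteristic `p`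
  carries a nonempty `IsTrap` set ALL OF WHOSE STATES ARE IN COORDINATE SCOPE (an «in-scope trap»: the
  join TRAP-census × EN-9 class COORDINATE-ONLY the engines can look for);
  `terminatesInScope_iff_forall_wins` (out-of-scope states are terminal = won for A; the permissible
  rule is patched with the point centre there, `exists_isPermissibleCentre_iff`);
* **`not_noIsolatedTrap_iff_exists_isolatedTrap`** — F4-I fails iff some field of characteristic `p`
  carries a nonempty set of ISOLATED states each with a `Step0`-successor inside the set.

Nothing here asserts that any such trap exists or not (the census: none found at `L = 6`, two lanes);
nothing here proves resolution of singularities in dimension ≥ 4 / characteristic `p`; counted 0;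
AI work, weaker than expert review.
bears_on: LADDER-RESOLUTION:D157-DOOR2 (res-dim4-pi · PR-12d). Supports stmt-ResolutionOfSingularities-16155
(helper).
-/

set_option linter.dupNamespace false

namespace Summit.ResolutionOfSingularities.ResolutionOfSingularities.Theorems.PIDim4

namespace FrameTraps

open Literature.AlgebraicGeometry.Resolution

/-! ## 1. F4-S: the spine game on states -/

section Spine

variable {K : Type} [Field K] [DecidableEq K] (q : ℕ)

/-- A rule is permissible and spine-terminating iff it is a positional strategy winning the game
(legal = permissible centre, answers = spine edges) from every state — definitional. [folklore] -/
theorem isPermissibleRule_and_spineTerminatesUnder_iff (R : CentreRule K) :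
    IsPermissibleRule q R ∧ SpineTerminatesUnder q R ↔
      Game.IsWinningPositional (fun (s : State K) (S : Finset (Fin 4)) => IsPermissibleCentre q S s.F)
        (fun s S s' => SpineEdge q S s s') R :=
  Iff.rfl

/-- Over one field: some permissible rule wins the spine game iff every state is in A's spine
attractor. [folklore] -/
theorem exists_spineRule_iff_forall_wins :
    (∃ R : CentreRule K, IsPermissibleRule q R ∧ SpineTerminatesUnder q R) ↔
      ∀ s : State K, Game.Wins (fun (s : State K) (S : Finset (Fin 4)) => IsPermissibleCentre q S s.F)
        (fun s S s' => SpineEdge q S s s') s := by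
  simp only [isPermissibleRule_and_spineTerminatesUnder_iff]
  exact (Game.forall_wins_iff_exists_isWinningPositional _ _).symm

/-- Over one field: every state is in the spine attractor iff there is no nonempty SPINE TRAP.
[folklore] -/
theorem forall_spineWins_iff_not_exists_spineTrap :
    (∀ s : State K, Game.Wins (fun (s : State K) (S : Finset (Fin 4)) => IsPermissibleCentre q S s.F)
        (fun s S s' => SpineEdge q S s s') s) ↔
      ¬ ∃ T : Set (State K), T.Nonempty ∧ ∀ s ∈ T,
        (q : ℕ∞) ≤ CentreBlowup.ordAlong Finset.univ s.F ∧
          ∀ S, IsPermissibleCentre q S s.F → ∃ s' ∈ T, SpineEdge q S s s' := by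
  rw [Game.forall_wins_iff_not_exists_trap]
  unfold Game.IsTrapSet
  simp only [exists_isPermissibleCentre_iff]

end Spine

/-- **F4-S ⟺ every state over every field of characteristic `p` is in the spine attractor.**
[OURS · frame bookkeeping] [folklore] -/
theorem spineTerminatesSomeRule_iff_forall_wins (p q : ℕ) :
    SpineTerminatesSomeRule p q ↔
      ∀ (K : Type) [Field K] [CharP K p] [DecidableEq K], ∀ s : State K,
        Game.Wins (fun (s : State K) (S : Finset (Fin 4)) => IsPermissibleCentre q S s.F)
          (fun s S s' => SpineEdge q S s s') s := by
  unfold SpineTerminatesSomeRule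
  refine forall_congr' fun K => forall_congr' fun _ => forall_congr' fun _ => forall_congr' fun _ => ?_
  exact exists_spineRule_iff_forall_wins q

/-- **Kill certificate for F4-S**: `SpineTerminatesSomeRule p q` FAILS iff some field of characteristic
`p` carries a nonempty SPINE TRAP — a set of `q`-fold states in which every permissible coordinate
centre is answered by a spine edge (chart ORIGIN) staying in the set. [OURS · frame bookkeeping]
[folklore] -/
theorem not_spineTerminatesSomeRule_iff_exists_spineTrap (p q : ℕ) :
    ¬ SpineTerminatesSomeRule p q ↔
      ∃ (K : Type) (_ : Field K) (_ : CharP K p) (_ : DecidableEq K) (T : Set (State K)),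
        T.Nonempty ∧ ∀ s ∈ T, (q : ℕ∞) ≤ CentreBlowup.ordAlong Finset.univ s.F ∧
          ∀ S, IsPermissibleCentre q S s.F → ∃ s' ∈ T, SpineEdge q S s s' := by
  rw [spineTerminatesSomeRule_iff_forall_wins]
  constructor
  · intro h
    by_contra hne
    apply h
    intro K _ _ _
    rw [forall_spineWins_iff_not_exists_spineTrap]
    rintro ⟨T, hT⟩
    exact hne ⟨K, ‹_›, ‹_›, ‹_›, T, hT⟩
  · rintro ⟨K, _, _, _, T, hT⟩ h
    have hK := h K
    rw [forall_spineWins_iff_not_exists_spineTrap] at hK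
    exact hK ⟨T, hT⟩

/-! ## 2. F4-C: branches inside the coordinate scope -/

section InScope

variable {K : Type} [Field K] [DecidableEq K] (q : ℕ)

/-- Over one field: «some permissible rule has no infinite in-scope branch» iff every state is in A's
attractor of the game whose legal moves are the permissible centres AT IN-SCOPE STATES (out-of-scope
states are terminal).  The rule extracted from the attractor is patched with the point centre at
out-of-scope `q`-fold states to make it permissible everywhere. [folklore] -/
theorem exists_inScopeRule_iff_forall_wins :
    (∃ R : CentreRule K, IsPermissibleRule q R ∧
        ¬ ∃ c : ℕ → State K, ∀ k, InCoordinateScope q (c k).F ∧ StepRule q R (c k) (c (k + 1))) ↔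
      ∀ s : State K, Game.Wins
        (fun (s : State K) (S : Finset (Fin 4)) => InCoordinateScope q s.F ∧ IsPermissibleCentre q S s.F)
        (fun s S s' => Edge q S s s') s := by
  classical
  constructor
  · rintro ⟨R, hR, hT⟩
    refine Game.wins_of_isWinningPositional _ _ (σ := R) ⟨fun s hs => ?_, ?_⟩
    · obtain ⟨S, hsc, hS⟩ := hs
      exact ⟨hsc, hR s ⟨S, hS⟩⟩
    · rintro ⟨c, hc⟩
      exact hT ⟨c, fun k => ⟨(hc k).1.1, (hc k).1.2, (hc k).2⟩⟩
  · intro h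
    obtain ⟨σ, hσ1, hσ2⟩ := Game.exists_isWinningPositional_of_forall_wins _ _ h
    refine ⟨fun s => if InCoordinateScope q s.F then σ s else Finset.univ, fun s hs => ?_, ?_⟩
    · show IsPermissibleCentre q (if InCoordinateScope q s.F then σ s else Finset.univ) s.F
      by_cases hsc : InCoordinateScope q s.F
      · rw [if_pos hsc]
        obtain ⟨S, hS⟩ := hs
        exact (hσ1 s ⟨S, hsc, hS⟩).2
      · rw [if_neg hsc]
        exact ⟨Finset.univ_nonempty, (exists_isPermissibleCentre_iff q s.F).mp hs⟩
    · rintro ⟨c, hc⟩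
      refine hσ2 ⟨c, fun k => ?_⟩
      obtain ⟨hsc, hperm, hedge⟩ := hc k
      simp only [if_pos hsc] at hperm hedge
      exact ⟨⟨hsc, hperm⟩, hedge⟩

/-- An abstract trap of the in-scope game is an `IsTrap` set all of whose states are in scope.
[folklore] -/
theorem isTrapSet_inScope_iff (T : Set (State K)) :
    Game.IsTrapSet
        (fun (s : State K) (S : Finset (Fin 4)) => InCoordinateScope q s.F ∧ IsPermissibleCentre q S s.F)
        (fun s S s' => Edge q S s s') T ↔
      IsTrap q T ∧ ∀ s ∈ T, InCoordinateScope q s.F := by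
  unfold Game.IsTrapSet IsTrap
  constructor
  · intro h
    refine ⟨fun s hs => ?_, fun s hs => ?_⟩
    · obtain ⟨⟨S, hsc, hS⟩, hall⟩ := h s hs
      exact ⟨(exists_isPermissibleCentre_iff q s.F).mp ⟨S, hS⟩, fun S' hS' => hall S' ⟨hsc, hS'⟩⟩
    · obtain ⟨⟨S, hsc, -⟩, -⟩ := h s hs
      exact hsc
  · rintro ⟨hT, hsc⟩ s hs
    obtain ⟨hord, hall⟩ := hT s hs
    obtain ⟨S, hS⟩ := (exists_isPermissibleCentre_iff q s.F).mpr hord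
    exact ⟨⟨S, hsc s hs, hS⟩, fun S' hS' => hall S' hS'.2⟩

/-- Over one field: every state is in the in-scope attractor iff there is no nonempty IN-SCOPE TRAP.
[folklore] -/
theorem forall_inScopeWins_iff_not_exists_inScopeTrap :
    (∀ s : State K, Game.Wins
        (fun (s : State K) (S : Finset (Fin 4)) => InCoordinateScope q s.F ∧ IsPermissibleCentre q S s.F)
        (fun s S s' => Edge q S s s') s) ↔
      ¬ ∃ T : Set (State K), T.Nonempty ∧ IsTrap q T ∧ ∀ s ∈ T, InCoordinateScope q s.F := by
  rw [Game.forall_wins_iff_not_exists_trap]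
  simp only [isTrapSet_inScope_iff]

end InScope

/-- **F4-C ⟺ every state over every field of characteristic `p` is in the in-scope attractor.**
[OURS · frame bookkeeping] [folklore] -/
theorem terminatesInScope_iff_forall_wins (p q : ℕ) :
    TerminatesInScope p q ↔
      ∀ (K : Type) [Field K] [CharP K p] [DecidableEq K], ∀ s : State K,
        Game.Wins
          (fun (s : State K) (S : Finset (Fin 4)) => InCoordinateScope q s.F ∧ IsPermissibleCentre q S s.F)
          (fun s S s' => Edge q S s s') s := by
  unfold TerminatesInScope
  refine forall_congr' fun K => forall_congr' fun _ => forall_congr' fun _ => forall_congr' fun _ => ?_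
  exact exists_inScopeRule_iff_forall_wins q

/-- **Kill certificate for F4-C**: `TerminatesInScope p q` FAILS iff some field of characteristic `p`
carries a nonempty trap (`IsTrap`) ALL OF WHOSE STATES ARE IN COORDINATE SCOPE.  The refuted
`TerminatesSomeRule 2 2` dies by the trap `{s₀}` of TRAP-1, whose state is OUT of scope (a regular
non-coordinate component of `Sing₂`); an in-scope trap is what F4-C forbids. [OURS · frame bookkeeping]
[folklore] -/
theorem not_terminatesInScope_iff_exists_inScopeTrap (p q : ℕ) :
    ¬ TerminatesInScope p q ↔
      ∃ (K : Type) (_ : Field K) (_ : CharP K p) (_ : DecidableEq K) (T : Set (State K)),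
        T.Nonempty ∧ IsTrap q T ∧ ∀ s ∈ T, InCoordinateScope q s.F := by
  rw [terminatesInScope_iff_forall_wins]
  constructor
  · intro h
    by_contra hne
    apply h
    intro K _ _ _
    rw [forall_inScopeWins_iff_not_exists_inScopeTrap]
    rintro ⟨T, hT⟩
    exact hne ⟨K, ‹_›, ‹_›, ‹_›, T, hT⟩
  · rintro ⟨K, _, _, _, T, hT⟩ h
    have hK := h K
    rw [forall_inScopeWins_iff_not_exists_inScopeTrap] at hK
    exact hK ⟨T, hT⟩

/-! ## 3. F4-I: point blow-ups through isolated `q`-fold points -/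

/-- **Kill certificate for F4-I**: `NoIsolatedTrap p q` FAILS iff some field of characteristic `p`
carries a nonempty set of states, each an ISOLATED `q`-fold point with a `Step0`-successor (point
blow-up, equimultiple point, cleaned, non-zero) inside the set.  (Player A has no choice in this regime,
so the trap is just a self-sustaining set; an infinite branch is its range.) [OURS · frame bookkeeping]
[folklore] -/
theorem not_noIsolatedTrap_iff_exists_isolatedTrap (p q : ℕ) :
    ¬ NoIsolatedTrap p q ↔
      ∃ (K : Type) (_ : Field K) (_ : CharP K p) (_ : DecidableEq K) (T : Set (State K)),
        T.Nonempty ∧ ∀ s ∈ T, IsIsolated q s.F ∧ ∃ s' ∈ T, Step0 q s s' := by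
  unfold NoIsolatedTrap
  constructor
  · intro h
    by_contra hne
    apply h
    intro K _ _ _
    rintro ⟨c, hc⟩
    exact hne ⟨K, ‹_›, ‹_›, ‹_›, Set.range c, ⟨c 0, 0, rfl⟩,
      by rintro _ ⟨k, rfl⟩; exact ⟨(hc k).1, c (k + 1), ⟨k + 1, rfl⟩, (hc k).2⟩⟩
  · rintro ⟨K, _, _, _, T, ⟨s₀, hs₀⟩, hT⟩ h
    apply h K
    have key : ∀ s : T, ∃ s' : T, IsIsolated q s.1.F ∧ Step0 q s.1 s'.1 := by
      rintro ⟨s, hs⟩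
      obtain ⟨hiso, s', hs', hstep⟩ := hT s hs
      exact ⟨⟨s', hs'⟩, hiso, hstep⟩
    choose f hf using key
    refine ⟨fun k => (f^[k] ⟨s₀, hs₀⟩).1, fun k => ?_⟩
    show IsIsolated q (f^[k] ⟨s₀, hs₀⟩).1.F ∧ Step0 q (f^[k] ⟨s₀, hs₀⟩).1 (f^[k + 1] ⟨s₀, hs₀⟩).1
    rw [Function.iterate_succ_apply']
    exact hf _

end FrameTraps

end Summit.ResolutionOfSingularities.ResolutionOfSingularities.Theorems.PIDim4
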